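import Summits.CriticalPhenomena.SAWScalingLimit.Theorems.SAWTotalPositivitySAWTraversalBound
import Literature.Probability.RandomPlanarGeometry.SelfAvoidingWalk
import Literature.Probability.RandomPlanarGeometry.PolylineShellTraversals
import Literature.Probability.RandomPlanarGeometry.CurveTortuosity
import Literature.Probability.LatticeModels.LatticeDobrushinDomain
import HarnessLib

/-!
# Eventual tightness of the critical planar SAW laws: transport of shell traversals

Step (V2) of the eventual-tightness argument (Aizenman–Burchard regularity through traversal
counts) for the critical SAW laws of the discrete domains `Ω_δ ⊆ δℤ²`. A critical SAW `γ` of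
`Ω_δ` is cut at its first entrance into / last exit from the closed LATTICE disc `B̄(z₀, N)`,
`δ z₀ = y`, `δ N = R_c`: `γ.walk.support = β ++ α ++ β'` with `β`, `β'` strictly outside the
circle. If the mesh-`δ` polyline of `γ` (`γ.walk.toCurve (meshPoint δ)`, the polyline through
`γ.walk.support.map (meshPoint δ)`) makes `j` separate traversals of the Euclidean shell
`D(y; η, R)` (`Curve.HasTraversals`), then for `0 < δ ≤ min (η' - η) (R - R')`
(`stub_travTransport`):

* some vertex of `γ` lies in `B̄(z₀, N)` as soon as `j ≥ 1`, and
* the vertex sequence `α.map Site.toComplex` of the middle piece makes `j` WEAK VERTEX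
  TRAVERSALS of the lattice shell `D(z₀; η'/δ, R'/δ)` (written out explicitly, exactly as in
  `VertexShellTraversals.lean`, which introduces no definition).

The proof is bookkeeping around `vertexTraversals_of_hasTraversals_polyline` (polyline →
vertex sequence, shell shrunk by the step `δ` of the mesh polyline, whose consecutive points are
`δ`-close: `isChain_dist_map_meshPoint_support` of `SAWTotalPositivitySAWTraversalBound.lean`),
`vertexTraversals_of_map` (rescaling by `δ⁻¹` about the origin) and `vertexTraversals_middle`
(restriction to the middle piece: the outer pieces avoid the inner ball, and the end points of
`α`, being lattice neighbours of vertices outside `B̄(z₀, N)`, are at distance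
`> N - 1 ≥ R'/δ`). Source: M. Aizenman, A. Burchard, Duke Math. J. 99 (1999), §3.a
(discretisation of traversal counts); folklore.
-/

noncomputable section

open MeasureTheory Filter Topology Set Metric
open scoped ENNReal NNReal unitInterval
open Literature.Probability.RandomPlanarGeometry Literature.Probability.LatticeModels

namespace Summit.CriticalPhenomena.SAWScalingLimit.Theorems

/-- `vertexTraversals_of_hasTraversals_polyline` for a nonempty list of points not syntactically
of the form `a :: l`: `k` separate traversals of `D(x; r, R)` by the polyline through `L`, whose
consecutive points are `ε`-close, give `k` weak vertex traversals of `D(x; r + ε, R - ε)` by `L`.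
[cite: AizenmanBurchardDuke1999, §3.a (proof of Lemma 3.1)] -/
theorem vertexTraversals_of_hasTraversals_polyline_of_ne_nil {L : List ℂ} (hL : L ≠ []) {ε : ℝ}
    (hε : 0 ≤ ε) (hl : List.IsChain (fun p q => dist p q ≤ ε) L) {k : ℕ} {x : ℂ} {r R : ℝ}
    (h : (⟨polyline L⟩ : Curve ℂ).HasTraversals k x r R) :
    ∃ ι κ : Fin k → Fin L.length, (∀ m, ι m ≤ κ m) ∧
      (∀ m, (dist (L.get (ι m)) x ≤ r + ε ∧ R - ε ≤ dist (L.get (κ m)) x) ∨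
        (R - ε ≤ dist (L.get (ι m)) x ∧ dist (L.get (κ m)) x ≤ r + ε)) ∧
      ∀ ⦃m m'⦄, m < m' → κ m ≤ ι m' := by
  obtain ⟨a, l, rfl⟩ := List.exists_cons_of_ne_nil hL
  exact vertexTraversals_of_hasTraversals_polyline hε hl h

/-- **From the mesh polyline of a lattice walk to its rescaled vertex sequence.** If the mesh-`δ`
polyline of a walk `w` of `Ω_δ` (`δ > 0`) makes `k` separate traversals of `D(δ z₀; r, R)` and
`r + δ ≤ r'`, `R' ≤ R - δ`, then the vertex sequence `w.support.map Site.toComplex` makes `k` weak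
vertex traversals of the lattice shell `D(z₀; r'/δ, R'/δ)`.
[cite: AizenmanBurchardDuke1999, §3.a (proof of Lemma 3.1)] -/
theorem vertexTraversals_support_of_hasTraversals_toCurve {Ω : Set ℂ} {δ : ℝ} (hδ : 0 < δ)
    {a b : Site 2} (w : (discreteDomainGraph Ω δ).Walk a b) (z₀ : ℂ) {k : ℕ} {r R r' R' : ℝ}
    (hr : r + δ ≤ r') (hR : R' ≤ R - δ)
    (h : (⟨w.toCurve (meshPoint δ)⟩ : Curve ℂ).HasTraversals k ((δ : ℂ) * z₀) r R) :
    ∃ ι κ : Fin k → Fin (w.support.map Site.toComplex).length, (∀ m, ι m ≤ κ m) ∧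
      (∀ m, (dist ((w.support.map Site.toComplex).get (ι m)) z₀ ≤ r' / δ ∧
          R' / δ ≤ dist ((w.support.map Site.toComplex).get (κ m)) z₀) ∨
        (R' / δ ≤ dist ((w.support.map Site.toComplex).get (ι m)) z₀ ∧
          dist ((w.support.map Site.toComplex).get (κ m)) z₀ ≤ r' / δ)) ∧
      ∀ ⦃m m'⦄, m < m' → κ m ≤ ι m' := by
  have h1 := vertexTraversals_mono (vertexTraversals_of_hasTraversals_polyline_of_ne_nil
    (L := w.support.map (meshPoint δ)) (fun h0 => w.support_ne_nil (List.map_eq_nil_iff.1 h0))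
    hδ.le (isChain_dist_map_meshPoint_support hδ.le w) h) hr hR
  have hmap : w.support.map (meshPoint δ) =
      (w.support.map Site.toComplex).map (fun z : ℂ => (δ : ℂ) * z) := by
    rw [List.map_map]; rfl
  rw [hmap] at h1
  -- the similarity `z ↦ δ z` multiplies distances to `z₀` by `δ`
  have hf : ∀ p : ℂ, dist ((δ : ℂ) * p) ((δ : ℂ) * z₀) = δ * dist p z₀ := fun p => by
    rw [dist_eq_norm, dist_eq_norm, ← mul_sub, norm_mul, Complex.norm_of_nonneg hδ.le]
  exact vertexTraversals_of_map hδ hf h1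

/-- **(V2) Transport of shell traversals to the cut configuration.** For
`0 < η < η' < R' < R < R_c` there is `δ₂ > 0` (namely `min (η' - η) (R - R')`) such that for every
mesh `0 < δ ≤ δ₂`, `δ z₀ = y`, `δ N = R_c`, and every SAW `γ` of `Ω_δ` whose mesh polyline makes
`j` separate traversals of `D(y; η, R)`: (a) if `j ≥ 1` some vertex of `γ` lies in the closed
lattice disc `B̄(z₀, N)`; (b) for every decomposition `γ.walk.support = β ++ α ++ β'` with `β`, `β'`
strictly outside that disc (and the book-keeping of the junction vertices), the vertex sequence
`α.map Site.toComplex` of the middle piece makes `j` weak vertex traversals of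
`D(z₀; η'/δ, R'/δ)`. [cite: AizenmanBurchardDuke1999, §3.a (proof of Lemma 3.1)] -/
theorem stub_travTransport :
    ∀ (y : ℂ) (η η' R' R Rc : ℝ), 0 < η → η < η' → η' < R' → R' < R → R < Rc →
      ∃ δ₂ : ℝ, 0 < δ₂ ∧ ∀ δ ∈ Set.Ioc (0 : ℝ) δ₂, ∀ (z₀ : ℂ) (N : ℝ),
        (δ : ℂ) * z₀ = y → δ * N = Rc →
        ∀ (Ω : Set ℂ) (a₀ b₀ : Site 2) (γ : SAW.DomainSAW Ω δ a₀ b₀) (j : ℕ),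
          (⟨γ.walk.toCurve (meshPoint δ)⟩ : Curve ℂ).HasTraversals j y η R →
          (1 ≤ j → ∃ v ∈ γ.walk.support, dist (Site.toComplex v) z₀ ≤ N) ∧
          ∀ (β α β' : List (Site 2)) (c c' u u' : Site 2),
            γ.walk.support = β ++ α ++ β' → α.head? = some c → α.getLast? = some c' →
            β.getLast? = some u → β'.head? = some u' →
            (∀ v ∈ β, N < dist (Site.toComplex v) z₀) →
            (∀ v ∈ β', N < dist (Site.toComplex v) z₀) →
            ∃ ι κ : Fin j → Fin (α.map Site.toComplex).length, (∀ m, ι m ≤ κ m) ∧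
              (∀ m, (dist ((α.map Site.toComplex).get (ι m)) z₀ ≤ η' / δ ∧
                  R' / δ ≤ dist ((α.map Site.toComplex).get (κ m)) z₀) ∨
                (R' / δ ≤ dist ((α.map Site.toComplex).get (ι m)) z₀ ∧
                  dist ((α.map Site.toComplex).get (κ m)) z₀ ≤ η' / δ)) ∧
              ∀ ⦃m m'⦄, m < m' → κ m ≤ ι m'  := by
  intro y η η' R' R Rc _hη hηη' hη'R' hR'R hRRc
  refine ⟨min (η' - η) (R - R'), lt_min (by linarith) (by linarith), ?_⟩
  rintro δ ⟨hδ, hδle⟩ z₀ N hy hN Ω a₀ b₀ γ j hj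
  have hδ₁ : δ ≤ η' - η := hδle.trans (min_le_left _ _)
  have hδ₂ : δ ≤ R - R' := hδle.trans (min_le_right _ _)
  subst hy hN
  -- radius bookkeeping: `η'/δ ≤ N = R_c/δ` and `R'/δ ≤ N - 1`
  have hη'N : η' / δ ≤ N := by
    rw [div_le_iff₀ hδ]; linarith
  have hR'N : R' / δ ≤ N - 1 := by
    rw [div_le_iff₀ hδ]; linarith
  -- the whole vertex sequence makes `j` weak vertex traversals of `D(z₀; η'/δ, R'/δ)`
  have hV := vertexTraversals_support_of_hasTraversals_toCurve hδ γ.walk z₀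
    (show η + δ ≤ η' by linarith) (show R' ≤ R - δ by linarith) hj
  refine ⟨fun hj1 => ?_, fun β α β' c c' u u' hS hc hc' hu hu' hβ hβ' => ?_⟩
  · -- (a): the first traversal has a vertex in the inner ball `B̄(z₀, η'/δ) ⊆ B̄(z₀, N)`
    obtain ⟨p, hp, hpz⟩ := exists_dist_le_of_vertexTraversals hV hj1
    obtain ⟨v, hv, rfl⟩ := List.mem_map.1 hp
    exact ⟨v, hv, hpz.trans hη'N⟩
  · -- (b): the junction vertices `u ~ c` and `c' ~ u'` are lattice neighbours
    have hchain := γ.walk.isChain_adj_support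
    rw [hS] at hchain
    obtain ⟨hβα, -, hlast⟩ := List.isChain_append.1 hchain
    obtain ⟨-, -, hfirst⟩ := List.isChain_append.1 hβα
    have huc : (discreteDomainGraph Ω δ).Adj u c := hfirst u (by simp [hu]) c (by simp [hc])
    have hc'u' : (discreteDomainGraph Ω δ).Adj c' u' :=
      hlast c' (by simp [hc']) u' (by simp [hu'])
    -- hence `c`, `c'` are at distance `> N - 1 ≥ R'/δ` from `z₀`
    have hstep : ∀ {v v' : Site 2}, (discreteDomainGraph Ω δ).Adj v v' →
        N < dist (Site.toComplex v) z₀ → N - 1 < dist (Site.toComplex v') z₀ := by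
      intro v v' hvv' hv
      have h1 := dist_toComplex_of_adj
        (meshGraph_le_zdGraph Ω δ (discreteDomainGraph_le_meshGraph Ω δ hvv'))
      have h2 := dist_triangle (Site.toComplex v) (Site.toComplex v') z₀
      linarith
    have hcfar := hstep huc (hβ u (List.mem_of_getLast? hu))
    have hc'far := hstep hc'u'.symm (hβ' u' (List.mem_of_head? hu'))
    -- restrict the weak vertex traversals to the middle piece
    rw [hS, List.map_append, List.map_append] at hV
    have hαne : α ≠ [] := by
      rintro rfl
      simp at hc
    have hne : α.map Site.toComplex ≠ [] := fun h0 => hαne (List.map_eq_nil_iff.1 h0)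
    refine vertexTraversals_middle hne hV (fun p hp => ?_) (fun p hp => ?_) ?_ ?_
    · obtain ⟨v, hv, rfl⟩ := List.mem_map.1 hp
      exact hη'N.trans_lt (hβ v hv)
    · obtain ⟨v, hv, rfl⟩ := List.mem_map.1 hp
      exact hη'N.trans_lt (hβ' v hv)
    · rw [List.head_map, (List.head_eq_iff_head?_eq_some hαne).2 hc]
      linarith
    · rw [List.getLast_map, (List.getLast_eq_iff_getLast?_eq_some hαne).2 hc']
      linarith

end Summit.CriticalPhenomena.SAWScalingLimit.Theorems

end
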